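import Literature.Probability.Percolation.GladkovThreeClusterDichotomyProofs
import Mathlib.Tactic.Linarith
import Mathlib.Tactic.Ring
import HarnessLib

/-!
# `NoHeavyLowerTail` (stmt-CriticalPhenomena-4575) — the switching form of the apex-pair row APL:
# `P(ab|c) + P(ac|b) ≥ P(a|b ∩ a|c)·P(ab ∪ ac) − P(C₁ ∈ a|bc, C₁ →_{S₃} C₂ ∈ abc)`

Support file (prover seat `prim-ineq-gen-8`, gen 28; `--supports stmt-CriticalPhenomena-4575`; memo
`run/shared/lean/prim/prim-ineq-gen-8/FINDING-gen28-APL-REGIME.md` §0, §2).  No definitions, no named facts, no sorries.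

SETTING (combinatorial, as in `GladkovThreeClusterDichotomyProofs`).  Configurations are finite sets of open pairs
`K ⊆ Sym2 V` of a finite vertex type weighted by `wtW univ p`; `PrW` / `Pr2W` are the probabilities of events of one /
of a pair of independent configurations; `cl K x` is the open cluster of `x`; `tri x y z = x|y|z`, `iso x y z = x|y ∩ x|z`;
`splice (S3map x y z C₁) C₁ C₂ = C₁ →_{S₃} C₂ =: H₃` is the Gladkov–Zimin hybrid that keeps `C₁` on the pairs touching
`Com_y ∪ Com_z` but not `Com_x` and takes `C₂` elsewhere [cite: Gladkov2024, Fig. 1 (Algorithm 5), Lemma 3.1, Lemma 7.1]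
[cite: GladkovZimin2024, §4].

WHAT IS PROVED (the exact book-keeping behind the conjectured reverse-Harris row APL of the new-inequality factory,
`P(ab|c) + P(ac|b) ≥ κ·P(a|b|c)·P(abc)` — OPEN; three-port `Z(3,2)` follows from it with `κ = 3/10`,
`ThreePort.pocketExchange_of_apl`):
* `APL.Pr2W_tri_S3_conn_le_pairs` — **`P(C₁ ∈ x|y|z, H₃ ∈ xy ∪ xz) ≤ P(xy|z) + P(xz|y)`** (Lemma 7.1 summed, then the `S₁`/`S₂`
  hybrids are `μ`-distributed and keep `Com_z` resp. `Com_y` sealed);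
* `APL.Pr2W_tri_S3_eq_sub` — `P(C₁ ∈ x|y|z, H₃ ∈ U) = P(x|y ∩ x|z)·P(U) − P(C₁ ∈ x|yz, H₃ ∈ U)` (the `S₃` identity split along
  `x|y ∩ x|z = x|y|z ⊔ x|yz`);
* `APL.mem_cl_splice_S3map_of_glued`, `APL.splice_S3map_conn_iff_of_glued` — on `C₁ ∈ x|yz` the glued cluster `Com_y = Com_z` is
  internally kept by `H₃`, so `H₃ ∈ xy ↔ H₃ ∈ xz` (re-sampling `x`'s side joins `x` to both targets or to neither);
* `APL.iso_mul_conn_le_pairs_add_glued` — **`P(x|y ∩ x|z)·P(xy ∪ xz) ≤ P(xy|z) + P(xz|y) + P(C₁ ∈ x|yz, H₃ ∈ xy ∩ xz)`**, which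
  refines GZ24 Thm 4.6 (`Gladkov.PrW_iso_mul_PrW_conn_le`, last term `P(x|yz)`) by `APL.Pr2W_glued_S3_le`.
In cells (`u0 = P(x|y|z)`, `u_bc = P(x|yz)`, `e = P(xy|z)+P(xz|y)`, `T = P(xy ∪ xz)`, `ρ := P(H₃ ∈ xyz | C₁ ∈ x|yz)`):
`e ≥ (u0 + u_bc)·T − u_bc·ρ`, i.e. `e ≥ u0·T − u_bc·(ρ − T)`; the conjectured APL₁(κ) is exactly the missing estimate
`E[ P_{C₂}(H₃ ∈ xy ∪ xz) | C₁ ∈ x|y|z ] ≥ κ·T` ("re-sampling the star of the separated cluster of `x` re-attaches `x`"),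
numerically `≥ 0.878·T` in hill-climbs over weighted graphs with `≤ 6` vertices, with equality `8/9·T` approached at pendant apexes (memo §2).  [this work]
-/

namespace Summit.CriticalPhenomena.PercolationContinuityZ3.Theorems

namespace APL

open Literature.Probability.Percolation Literature.Probability.Percolation.Gladkov
  Literature.Probability.Percolation.DecisionTree
open scoped Classical

variable {V : Type*} [Fintype V] [DecidableEq V]

section Pointwise

/-- **The glued target cluster is kept by `H₃`.**  If `y ∉ Com_x(C₁)` and `z ∈ Com_y(C₁)` (so `C₁ ∈ x|yz`), then `z` lies in
the cluster of `y` in the hybrid `C₁ →_{S₃} C₂`: every `C₁`-open pair inside `Com_y(C₁)` touches `Com_y` and misses `Com_x`,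
hence belongs to `S₃` and is kept. [this work] -/
theorem mem_cl_splice_S3map_of_glued {x y z : V} {K₁ : Finset (Sym2 V)} (K₂ : Finset (Sym2 V))
    (hxy : y ∉ cl K₁ x) (hyz : z ∈ cl K₁ y) :
    z ∈ cl (splice (S3map x y z K₁) K₁ K₂) y := by
  have hC : ∀ u v, u ∈ cl K₁ y → (openGraph (↑K₁ : Set (Sym2 V))).Adj u v → v ∈ cl K₁ y :=
    fun u v hu huv => mem_cl_of_adj hu huv
  have hx_of : ∀ u, u ∈ cl K₁ y → u ∉ cl K₁ x := fun u hu =>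
    not_mem_cl_of_mem_cl hu fun h => hxy (mem_cl_comm.1 h)
  have hGG' : ∀ u v, u ∈ cl K₁ y → (openGraph (↑K₁ : Set (Sym2 V))).Adj u v →
      (openGraph (↑(splice (S3map x y z K₁) K₁ K₂) : Set (Sym2 V))).Adj u v := by
    intro u v hu huv
    have hv : v ∈ cl K₁ y := mem_cl_of_adj hu huv
    rw [adj_iff] at huv ⊢
    refine ⟨?_, huv.2⟩
    have hmem : s(u, v) ∈ S3map x y z K₁ := by
      show s(u, v) ∈ touch (cl K₁ y ∪ cl K₁ z) \ touch (cl K₁ x)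
      rw [Finset.mem_sdiff, mk_mem_touch, mk_mem_touch]
      exact ⟨Or.inl (Finset.mem_union_left _ hu), fun h => h.elim (hx_of u hu) (hx_of v hv)⟩
    exact (mem_splice_of_mem hmem).2 huv.1
  obtain ⟨w⟩ := mem_cl.1 hyz
  exact mem_cl.2 (reachable_of_walk hC hGG' w (mem_cl_self K₁ y))

/-- **Re-sampling the side of `x` joins it to both glued targets or to neither**: for `C₁ ∈ x|yz`,
`C₁ →_{S₃} C₂ ∈ xy ↔ C₁ →_{S₃} C₂ ∈ xz`. [this work] -/
theorem splice_S3map_conn_iff_of_glued {x y z : V} {K₁ : Finset (Sym2 V)} (K₂ : Finset (Sym2 V))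
    (hxy : y ∉ cl K₁ x) (hyz : z ∈ cl K₁ y) :
    splice (S3map x y z K₁) K₁ K₂ ∈ conn x y ↔ splice (S3map x y z K₁) K₁ K₂ ∈ conn x z := by
  have hz := mem_cl.1 (mem_cl_splice_S3map_of_glued K₂ hxy hyz)
  rw [mem_conn, mem_conn]
  exact ⟨fun h => h.trans hz, fun h => h.trans hz.symm⟩

end Pointwise

section Switching

variable {p : Sym2 V → ℝ} (hp0 : ∀ i, 0 ≤ p i) (hp1 : ∀ i, p i ≤ 1) (x y z : V)
include hp0 hp1

/-- **Lemma 7.1 as a lower bound for the apex-pair cells**: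
`P(C₁ ∈ x|y|z, C₁ →_{S₃} C₂ ∈ xy ∪ xz) ≤ P(xy|z) + P(xz|y)`.
(Gladkov's proof of Lemma 1.2 keeps `C₁ ∈ x|y|z` on the right and applies Cauchy–Schwarz; dropping it gives this linear form.)
[cite: Gladkov2024, Lemma 7.1 and §7.1] [this work] -/
theorem Pr2W_tri_S3_conn_le_pairs :
    Pr2W Finset.univ p {w | w.1 ∈ tri x y z ∧ splice (S3map x y z w.1) w.1 w.2 ∈ conn x y ∪ conn x z} ≤
      PrW Finset.univ p {K | y ∈ cl K x ∧ z ∉ cl K x} + PrW Finset.univ p {K | z ∈ cl K x ∧ y ∉ cl K x} := by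
  have h1 := Pr2W_tri_S3_le hp0 hp1 x y z
  have h4 := Pr2W_tri_S1_conn_le hp0 hp1 x y z
  have h5 := Pr2W_tri_S1_conn_le hp0 hp1 x z y
  rw [tri_swap] at h5
  linarith

omit hp0 hp1 in
/-- **The `S₃` identity split along `x|y ∩ x|z = x|y|z ⊔ x|yz`**:
`P(C₁ ∈ x|y|z, H₃ ∈ U) = P(x|y ∩ x|z)·P(U) − P(C₁ ∈ x|yz, H₃ ∈ U)`.
[cite: Gladkov2024, Lemma 3.1 and §7.1] [this work] -/
theorem Pr2W_tri_S3_eq_sub (U : Set (Finset (Sym2 V))) :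
    Pr2W Finset.univ p {w | w.1 ∈ tri x y z ∧ splice (S3map x y z w.1) w.1 w.2 ∈ U} =
      PrW Finset.univ p (iso x y z) * PrW Finset.univ p U -
        Pr2W Finset.univ p {w | w.1 ∈ iso x y z \ tri x y z ∧ splice (S3map x y z w.1) w.1 w.2 ∈ U} := by
  rw [← Pr2W_iso_S3_eq (p := p) x y z U]
  have hdisj : Disjoint
      {w : Finset (Sym2 V) × Finset (Sym2 V) | w.1 ∈ tri x y z ∧ splice (S3map x y z w.1) w.1 w.2 ∈ U}
      {w | w.1 ∈ iso x y z \ tri x y z ∧ splice (S3map x y z w.1) w.1 w.2 ∈ U} := by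
    rw [Set.disjoint_left]
    rintro w ⟨h1, -⟩ ⟨h2, -⟩
    exact h2.2 h1
  have hunion : {w : Finset (Sym2 V) × Finset (Sym2 V) | w.1 ∈ iso x y z ∧ splice (S3map x y z w.1) w.1 w.2 ∈ U} =
      {w | w.1 ∈ tri x y z ∧ splice (S3map x y z w.1) w.1 w.2 ∈ U} ∪
        {w | w.1 ∈ iso x y z \ tri x y z ∧ splice (S3map x y z w.1) w.1 w.2 ∈ U} := by
    ext w
    simp only [Set.mem_setOf_eq, Set.mem_union, Set.mem_sdiff]
    constructor
    · rintro ⟨hi, hU⟩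
      by_cases ht : w.1 ∈ tri x y z
      · exact Or.inl ⟨ht, hU⟩
      · exact Or.inr ⟨⟨hi, ht⟩, hU⟩
    · rintro (⟨ht, hU⟩ | ⟨⟨hi, -⟩, hU⟩)
      · exact ⟨tri_subset_iso x y z ht, hU⟩
      · exact ⟨hi, hU⟩
  rw [hunion, Pr2W_union Finset.univ p hdisj]
  ring

omit hp0 hp1 in
/-- On the glued stratum `x|yz` the hybrid `H₃` joins `x` to `y` or `z` iff it joins `x` to both:
`P(C₁ ∈ x|yz, H₃ ∈ xy ∪ xz) = P(C₁ ∈ x|yz, H₃ ∈ xy ∩ xz)`. [this work] -/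
theorem Pr2W_glued_S3_conn_union_eq_inter :
    Pr2W Finset.univ p {w | w.1 ∈ iso x y z \ tri x y z ∧
        splice (S3map x y z w.1) w.1 w.2 ∈ conn x y ∪ conn x z} =
      Pr2W Finset.univ p {w | w.1 ∈ iso x y z \ tri x y z ∧
        splice (S3map x y z w.1) w.1 w.2 ∈ conn x y ∩ conn x z} := by
  refine Pr2W_congr_set Finset.univ p fun w _ _ => ?_
  simp only [Set.mem_setOf_eq]
  constructor
  · rintro ⟨hg, hU⟩
    have hyz : z ∈ cl w.1 y := by
      have h3 : ¬ (y ∉ cl w.1 z) := fun h => hg.2 ⟨hg.1.1, hg.1.2, h⟩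
      exact mem_cl_comm.1 (not_not.1 h3)
    have key := splice_S3map_conn_iff_of_glued w.2 hg.1.1 hyz
    rcases hU with h | h
    · exact ⟨hg, h, key.1 h⟩
    · exact ⟨hg, key.2 h, h⟩
  · rintro ⟨hg, h1, -⟩
    exact ⟨hg, Or.inl h1⟩

/-- The glued term is at most `P(x|yz)` (so the next theorem refines GZ24 Thm 4.6). [folklore] -/
theorem Pr2W_glued_S3_le :
    Pr2W Finset.univ p {w | w.1 ∈ iso x y z \ tri x y z ∧
        splice (S3map x y z w.1) w.1 w.2 ∈ conn x y ∩ conn x z} ≤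
      PrW Finset.univ p (iso x y z \ tri x y z) := by
  rw [← Pr2W_fst Finset.univ p (iso x y z \ tri x y z)]
  exact Pr2W_mono _ hp0 hp1 fun w _ _ hw => hw.1

/-- **The switching form of APL** (all finite weighted graphs):
`P(x|y ∩ x|z)·P(xy ∪ xz) ≤ P(xy|z) + P(xz|y) + P(C₁ ∈ x|yz, C₁ →_{S₃} C₂ ∈ xy ∩ xz)`;
in cells `e ≥ (u0 + u_bc)·T − u_bc·ρ` with `ρ = P(H₃ ∈ xyz | C₁ ∈ x|yz) ≤ 1` (GZ24 Thm 4.6 is the case `ρ ≤ 1`).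
The conjectured row APL₁(κ) (`e ≥ κ·u0·u3`, OPEN) is equivalent on the stratum `u0 ≪ u_bc` to `ρ ≤ T + (1−κ)·T·u0/u_bc`.
[cite: Gladkov2024, Lemma 7.1, Lemma 3.1] [cite: GladkovZimin2024, Thm. 4.6] [this work] -/
theorem iso_mul_conn_le_pairs_add_glued :
    PrW Finset.univ p (iso x y z) * PrW Finset.univ p (conn x y ∪ conn x z) ≤
      PrW Finset.univ p {K | y ∈ cl K x ∧ z ∉ cl K x} + PrW Finset.univ p {K | z ∈ cl K x ∧ y ∉ cl K x} +
        Pr2W Finset.univ p {w | w.1 ∈ iso x y z \ tri x y z ∧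
          splice (S3map x y z w.1) w.1 w.2 ∈ conn x y ∩ conn x z} := by
  have h1 := Pr2W_tri_S3_conn_le_pairs hp0 hp1 x y z
  have h2 := Pr2W_tri_S3_eq_sub (p := p) x y z (conn x y ∪ conn x z)
  have h3 := Pr2W_glued_S3_conn_union_eq_inter (p := p) x y z
  linarith

/-- **APL from the switching estimate.**  If re-sampling re-attaches —
`κ·P(x|y|z)·P(xy ∪ xz) ≤ P(C₁ ∈ x|y|z, C₁ →_{S₃} C₂ ∈ xy ∪ xz)` (the conjectured CLAIM Θ of the memo; in hill-climbs over
weighted graphs with `≤ 6` vertices the ratio never fell below `0.878`) — then `κ·P(x|y|z)·P(xy ∪ xz) ≤ P(xy|z) + P(xz|y)`, which contains the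
factory's row APL₁(κ): `κ·P(x|y|z)·P(xyz) ≤ P(xy|z) + P(xz|y)`. [this work] -/
theorem pairs_ge_of_switching {κ : ℝ}
    (hΘ : κ * (PrW Finset.univ p (tri x y z) * PrW Finset.univ p (conn x y ∪ conn x z)) ≤
      Pr2W Finset.univ p {w | w.1 ∈ tri x y z ∧ splice (S3map x y z w.1) w.1 w.2 ∈ conn x y ∪ conn x z}) :
    κ * (PrW Finset.univ p (tri x y z) * PrW Finset.univ p (conn x y ∪ conn x z)) ≤
      PrW Finset.univ p {K | y ∈ cl K x ∧ z ∉ cl K x} + PrW Finset.univ p {K | z ∈ cl K x ∧ y ∉ cl K x} :=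
  hΘ.trans (Pr2W_tri_S3_conn_le_pairs hp0 hp1 x y z)

end Switching

end APL

end Summit.CriticalPhenomena.PercolationContinuityZ3.Theorems
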